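import Literature.NumberTheory.GaloisCohomology.MuPadicTwistMor
import Literature.NumberTheory.PAdicHodge.TatePairingCochainFilOne
import HarnessLib

/-!
# Scaling `B_dR⁺`-valued presentations by `p`-adic integers: `a · g` presents `c^a` through the period line

Topic `Literature/NumberTheory/PAdicHodge`; THEOREMS ONLY. Sequel of `GaloisCohomology/MuPadicTwistMor` (`twistCocycle₂ a c = c^a`,
`inv_∞[c^a] = a · inv_∞[c]`, `IsCoboundaryLift.twist_muPadic`) and `TateTwistPeriodLine` (`periodLine_twistHom : ι(ζ^a) = a · ι(ζ)`):

* ★ `BdRPlusTop.isCoboundaryLift_qpToBdR_mul_twist` — if `g : Γ_F → B_dR⁺(F)` presents the `ℤ_p(1)`-valued `2`-cocycle `c` through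
  `ι = periodLine`, then **`σ ↦ a · g(σ)` presents `c^a`** (`a ∈ ℤ_p`);
* ★ `tatePairing_mul_eq_invPadic_of_bdRPlus_presentation` — hence **`a · ⟨[η], [κ]⟩ = inv_∞[c']` for every presentation `c'` of
  `σ ↦ a · g⁺(σ)`**, `g⁺` any `B_dR⁺`-valued presentation of `η ∪_{e_∞} κ` (`TatePairingCochainFilOne`): the left-hand side of Kato's
  reciprocity law may be compared with the calibration classes `[κ_u ∪ ψ]` up to `p`-adic INTEGER multiples on either side
  (`IsCoboundaryLift.twoCocycleClass_eq`).

Line `kato_lever` of crux K★ `stmt-BirchSwinnertonDyer-22226`; BSD / K★ / [REC] are NOT proved by any of this.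

## References
* K. Kato, LNM 1553 (1993), Ch. II §1.4, proof of Lemma 1.4.3. [Kato1993LNM1553]
* J. Neukirch, A. Schmidt, K. Wingberg (2008), I §3 (1.3.2). [NeukirchSchmidtWingberg2008]
-/

noncomputable section

open Field Function ValuativeRel WittVector

namespace Literature.NumberTheory.PAdicHodge

open Literature.NumberTheory.GaloisRepresentations
open Literature.NumberTheory.GaloisRepresentations.IsNonarchimedeanLocalField
open Literature.NumberTheory.GaloisCohomology
open Literature.NumberTheory.EllipticCurves
open _root_.WeierstrassCurve

variable {F : Type} [Field F] [ValuativeRel F] [TopologicalSpace F] [IsNonarchimedeanLocalField F] [CharZero F]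
  {p : ℕ} [Fact p.Prime] [Fact (¬ IsUnit (p : integerC F))] [IsAdicComplete (Ideal.span {(p : integerC F)}) (integerC F)]

/-- ★ **`σ ↦ a · g(σ)` presents `c^a` through the period line** whenever `g` presents `c` (`ι(ζ^a) = a · ι(ζ)`, and multiplication by
`a ∈ ℚ_p ⊆ B_dR⁺` commutes with `Γ_F`). [cite: Kato1993LNM1553, Ch. II §1.4] [cite: NeukirchSchmidtWingberg2008, I §3 (1.3.2)] -/
theorem BdRPlusTop.isCoboundaryLift_qpToBdR_mul_twist {g : absoluteGaloisGroup F → BdRPlusTop F p}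
    {c : contTwoCocycles (tateModuleMuPadic F p).toTopRep}
    (hg : IsCoboundaryLift (ρ := tateModuleMuPadic F p) (BdRPlusTop.galRepr F p) (BdRPlusTop.periodLine F p) g c) (a : ℤ_[p]) :
    IsCoboundaryLift (ρ := tateModuleMuPadic F p) (BdRPlusTop.galRepr F p) (BdRPlusTop.periodLine F p)
      (fun σ => BdRPlusTop.of F p (qpToBdR (a : ℚ_[p])) * g σ) (twistCocycle₂ a c) :=
  hg.twist_muPadic a (AddMonoidHom.mulLeft (BdRPlusTop.of F p (qpToBdR (a : ℚ_[p]))))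
    (fun σ b => by
      change BdRPlusTop.of F p (qpToBdR (a : ℚ_[p])) * BdRPlusTop.gal F p σ b =
        BdRPlusTop.gal F p σ (BdRPlusTop.of F p (qpToBdR (a : ℚ_[p])) * b)
      rw [map_mul, BdRPlusTop.gal_of, galBdRPlus_qpToBdR])
    fun ζ => by
      change BdRPlusTop.of F p (qpToBdR (a : ℚ_[p])) * BdRPlusTop.periodLine F p ζ = _
      rw [BdRPlusTop.periodLine_twistHom]

variable {K₀ : Type} [Field K₀] (W : WeierstrassCurve K₀) [Algebra K₀ F]
  (e : (k : ℕ) → geomTorsion W ((p ^ k : ℕ) : ℤ) → geomTorsion W ((p ^ k : ℕ) : ℤ) → AlgebraicClosure K₀)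
  (hμ : ∀ k S T, e k S T ^ (p ^ k) = 1) (hadd₁ : ∀ k S₁ S₂ T, e k (S₁ + S₂) T = e k S₁ T * e k S₂ T)
  (hadd₂ : ∀ k S T₁ T₂, e k S (T₁ + T₂) = e k S T₁ * e k S T₂)
  (hgal : ∀ k (σ : absoluteGaloisGroup K₀) (S T : geomTorsion W ((p ^ k : ℕ) : ℤ)), σ • e k S T = e k (σ • S) (σ • T))
  (hcompat : ∀ k (S T : geomTorsion W ((p ^ (k + 1) : ℕ) : ℤ)),
    e k (torsionMulHom W (p ^ (k + 1)) (p ^ k) p (pow_succ p k).symm S)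
      (torsionMulHom W (p ^ (k + 1)) (p ^ k) p (pow_succ p k).symm T) = e (k + 1) S T ^ p)

variable [W.IsElliptic] [LocallyCompactSpace (absoluteGaloisGroup F)] [CharZero K₀]

include hgal in
/-- ★ **`a · ⟨[η], [κ]⟩ = inv_∞[c']` for every presentation `c'` through the period line of the SCALED cochain `σ ↦ a · g(σ)`**, `g` any
`B_dR⁺`-valued presentation of `η ∪_{e_∞} κ` (e.g. the `Fil¹`-valued `g⁺` of `exists_isCoboundaryLift_bdRPlus_of_isFilZeroCoboundary`).
[cite: Kato1993LNM1553, Ch. II §1.4, Thm. 1.4.1 (3) and proof of Lemma 1.4.3] -/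
theorem tatePairing_mul_eq_invPadic_of_bdRPlus_presentation (hF : Function.Surjective (fontaineTheta (integerC F) p))
    (η κ : contOneCocycles (restrictedTateRep W F p).toTopRep) (a : ℤ_[p])
    {g : absoluteGaloisGroup F → BdRPlusTop F p}
    (hg : IsCoboundaryLift (ρ := tateModuleMuPadic F p) (BdRPlusTop.galRepr F p) (BdRPlusTop.periodLine F p) g
      ((weilContPairingPadic W F p e hμ hadd₁ hadd₂ hgal hcompat).cupCocycle η κ))
    {c' : contTwoCocycles (tateModuleMuPadic F p).toTopRep}
    (hc' : IsCoboundaryLift (ρ := tateModuleMuPadic F p) (BdRPlusTop.galRepr F p) (BdRPlusTop.periodLine F p)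
      (fun σ => BdRPlusTop.of F p (qpToBdR (a : ℚ_[p])) * g σ) c') :
    a * tatePairing W F p e hμ hadd₁ hadd₂ hgal hcompat (oneCocycleClass _ η) (oneCocycleClass _ κ) =
      invPadic F p (twoCocycleClass _ c') := by
  rw [tatePairing_oneCocycleClass_eq_invPadic_twoCocycleClass, ← invPadic_twoCocycleClass_twistCocycle₂,
    (BdRPlusTop.isCoboundaryLift_qpToBdR_mul_twist hg a).unique (BdRPlusTop.periodLine_injective hF) hc']

end Literature.NumberTheory.PAdicHodge

end
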